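import Summits.Ventures.CertifiedManyBodySolver.Downfold.EmeryFermiVelocityScaleCheck
import Summits.Ventures.CertifiedManyBodySolver.Downfold.EmeryFermiFillingGrid384
import HarnessLib

/-!
# The one-band scale at the Fermi surface, IV: POINT rows — a printed three-band one-body set ⇒ its Fermi energy at a
# given filling to grid precision (`K = 384` row-threshold certificates) ⇒ the certified velocity-matched scale `t_eff`

Venture CertifiedManyBodySolver, cell `pub/hubbard-downfold` (stage S1), seat hubbard-downfold-mod-4 (technique B); namespace
`Summit.Ventures.CertifiedManyBodySolver.Downfold.Emery`. Everything here is PROVED. WHAT THIS IS NOT: a statement about any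
material; no number lives here; `U = 0` band kinematics. WHY POINTS: the scale `t_eff = fsT/∂_ε charCubic` moves by
≈ −0.5 %/meV·10 with the Fermi level, so a product «parameter sub-box × Fermi-energy bracket» decorrelates it (the box census of
`EmeryFermiFilling*` brackets ε_F to ±0.4 eV per sub-box); a printed one-body SET (a rational point) with its own filling has a
Fermi energy certified to the grid resolution (±0.005 in `abFilling` at `K = 384`, i.e. a few meV), and the scale follows sharply.

* `cAQ, fsDQ, fsNQ` — exact rational evaluations of `cA, fsD, fsN` at a rational point (`cast_cAQ`, …).
* `pointBracketCheck Δ a b c e₁ e₂ ν₁ ν₂ jout jin` — two ROW-THRESHOLD certificates of `EmeryFermiFillingRows` on the certified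
  `K = 384` grid `gridEncl384`: outer count at `e₁` below `ν₁`, inner count at `e₂` above `ν₂`; soundness
  `fermiEnergy_mem_Icc_of_pointBracketCheck`: every `ε` with `abFilling(ε) ∈ [ν₁, ν₂]` lies in `[e₁, e₂]`.
* `pointScale_of_checks` — composed with `scaleCheckPieces` on the degenerate box: at such `ε`, at every zone contour point,
  `∂_ε charCubic > 0` and `scaleT ∈ [lo, hi]`; `pointScale_faithful_of_checks` — any two Fermi points satisfy
  `scaleT(k) ≤ (1 + φ)·scaleT(k′)`.

Sources: [HybertsenSchluterChristensen1989, Eq. (1)]; [AndersenEtAl1995, §6]; interval arithmetic [folklore] (Moore 1966).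
-/

noncomputable section

namespace Summit.Ventures.CertifiedManyBodySolver.Downfold.Emery

open Real Set

/-- Exact rational value of `cA = e(Δ + e)²` at a rational point. [folklore] -/
def cAQ (Δ e : ℚ) : ℚ := e * (Δ + e) ^ 2

/-- Exact rational value of `fsD = (Δ + e)(a² − c·e)` at a rational point. [folklore] -/
def fsDQ (Δ a c e : ℚ) : ℚ := (Δ + e) * (a ^ 2 - c * e)

/-- Exact rational value of `fsN = 2a²(c + b) + e(b² − c²)` at a rational point. [folklore] -/
def fsNQ (a b c e : ℚ) : ℚ := 2 * a ^ 2 * (c + b) + e * (b ^ 2 - c ^ 2)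

/-- `cAQ` casts to `cA`. [folklore] -/
theorem cast_cAQ (Δ e : ℚ) : ((cAQ Δ e : ℚ) : ℝ) = cA Δ e := by
  unfold cAQ cA; push_cast; ring

/-- `fsDQ` casts to `fsD`. [folklore] -/
theorem cast_fsDQ (Δ a c e : ℚ) : ((fsDQ Δ a c e : ℚ) : ℝ) = fsD Δ a c e := by
  unfold fsDQ fsD; push_cast; ring

/-- `fsNQ` casts to `fsN`. [folklore] -/
theorem cast_fsNQ (a b c e : ℚ) : ((fsNQ a b c e : ℚ) : ℝ) = fsN a b c e := by
  unfold fsNQ fsN; push_cast; ring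

/-- **`pointBracketCheck`** — the Fermi-energy bracket of a printed one-body SET at a filling window: an OUTER row-threshold
certificate at `e₁` whose count is `< ν₁·K²` and an INNER row-threshold certificate at `e₂` whose count is `> ν₂·K²`, on the
certified `K = 384` grid (`xl384 / xh384`), with the sign side conditions. [folklore] -/
def pointBracketCheck (Δ a b c e₁ e₂ ν₁ ν₂ : ℚ) (jout jin : List ℕ) : Bool :=
  decide (0 ≤ e₁) && decide (e₁ ≤ e₂) && decide (0 ≤ Δ) && decide (0 ≤ a) && decide (0 ≤ b) && decide (0 ≤ c) &&
  decide (0 ≤ fsDQ Δ a c e₁) && decide (0 ≤ fsNQ a b c e₁) &&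
  decide (0 ≤ fsDQ Δ a c e₂) && decide (0 ≤ fsNQ a b c e₂) &&
  rowOuterCheck 384 xl384 (cAQ Δ e₁) (fsDQ Δ a c e₁) (fsNQ a b c e₁) (fun i => jout.getD i 0) &&
  decide (((rowSum 384 (fun i => jout.getD i 0) : ℕ) : ℚ) < ν₁ * 384 ^ 2) &&
  rowInnerCheck 384 xh384 e₂ (cAQ Δ e₂) (fsDQ Δ a c e₂) (fsNQ a b c e₂) Δ (a ^ 2) (b ^ 2) (fun i => jin.getD i 0) &&
  decide (ν₂ * 384 ^ 2 < ((rowSum 384 (fun i => jin.getD i 0) : ℕ) : ℚ))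

/-- **Soundness of `pointBracketCheck`**: at the rational point, every energy `ε` whose filling `abFilling(ε)` lies in
`[ν₁, ν₂]` lies in `[e₁, e₂]`. [folklore] -/
theorem fermiEnergy_mem_Icc_of_pointBracketCheck {Δ a b c e₁ e₂ ν₁ ν₂ : ℚ} {jout jin : List ℕ}
    (h : pointBracketCheck Δ a b c e₁ e₂ ν₁ ν₂ jout jin = true) {ε : ℝ}
    (hν : abFilling Δ a b c ε ∈ Set.Icc (ν₁ : ℝ) ν₂) : ε ∈ Set.Icc (e₁ : ℝ) e₂ := by
  simp only [pointBracketCheck, Bool.and_eq_true, decide_eq_true_eq] at h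
  obtain ⟨⟨⟨⟨⟨⟨⟨⟨⟨⟨⟨⟨⟨he₁, he⟩, hΔ⟩, ha⟩, hb⟩, hc⟩, hD₁⟩, hN₁⟩, hD₂⟩, hN₂⟩, hout⟩, hso⟩, hin⟩, hsi⟩ := h
  have hK : 0 < 384 := by norm_num
  -- OUTER at e₁
  have hOutR : abFilling (Δ : ℝ) a b c (e₁ : ℝ) ≤
      ((rowSum 384 (fun i => jout.getD i 0) : ℕ) : ℝ) / ((384 : ℕ) : ℝ) ^ 2 := by
    refine abFilling_le_rowSum_outer hK gridEncl384 hout ?_ ?_ ?_ hD₁ hN₁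
    · rw [cast_cAQ]
    · rw [cast_fsDQ]
    · rw [cast_fsNQ]
  -- INNER at e₂
  have hInR : ((rowSum 384 (fun i => jin.getD i 0) : ℕ) : ℝ) / ((384 : ℕ) : ℝ) ^ 2 ≤
      abFilling (Δ : ℝ) a b c (e₂ : ℝ) := by
    refine rowSum_inner_le_abFilling hK gridEncl384 hin ?_ ?_ ?_ hD₂ hN₂ le_rfl hΔ (by exact_mod_cast hc) ?_ ?_
      (he₁.trans he)
    · rw [cast_cAQ]
    · rw [cast_fsDQ]
    · rw [cast_fsNQ]
    · push_cast; exact le_rfl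
    · push_cast; exact le_rfl
  have hso' : ((rowSum 384 (fun i => jout.getD i 0) : ℕ) : ℝ) / ((384 : ℕ) : ℝ) ^ 2 < (ν₁ : ℝ) := by
    rw [div_lt_iff₀ (by positivity)]
    have := (Rat.cast_lt (K := ℝ)).2 hso
    push_cast at this ⊢
    exact this
  have hsi' : (ν₂ : ℝ) < ((rowSum 384 (fun i => jin.getD i 0) : ℕ) : ℝ) / ((384 : ℕ) : ℝ) ^ 2 := by
    rw [lt_div_iff₀ (by positivity)]
    have := (Rat.cast_lt (K := ℝ)).2 hsi
    push_cast at this ⊢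
    exact this
  exact fermiEnergy_mem_Icc_of_abFilling_mem hOutR hso' hInR hsi' hν

/-- **THE POINT SCALE THEOREM**: a printed one-body set (rational `Δ_pd, t_pd, t_pp, t_pp′`), a filling window `[ν₁, ν₂]` with
its certified Fermi-energy bracket `[e₁, e₂]` (`pointBracketCheck`) and a passing `scaleCheckPieces` on the degenerate box give:
for every `ε` with `abFilling(ε) ∈ [ν₁, ν₂]` and every zone contour point — `ε ∈ [e₁, e₂]`, `∂_ε charCubic > 0` and the
velocity-matched one-band scale `scaleT ∈ [lo, hi]`. [folklore] -/
theorem pointScale_of_checks {Δ a b c e₁ e₂ ν₁ ν₂ lo hi φ : ℚ} {jout jin : List ℕ} {m : ℕ} {σ0s : List ℚ}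
    (hbr : pointBracketCheck Δ a b c e₁ e₂ ν₁ ν₂ jout jin = true)
    (hsc : scaleCheckPieces Δ Δ a a b b c c e₁ e₂ m σ0s lo hi φ = true)
    {ε x y : ℝ} (hν : abFilling Δ a b c ε ∈ Set.Icc (ν₁ : ℝ) ν₂)
    (hx : x ∈ Set.Icc (0 : ℝ) 1) (hy : y ∈ Set.Icc (0 : ℝ) 1) (hP : charCubic Δ a b c x y ε = 0) :
    ε ∈ Set.Icc (e₁ : ℝ) e₂ ∧ 0 < dcharCubic Δ a b c x y ε ∧ scaleT Δ a b c x y ε ∈ Set.Icc (lo : ℝ) hi := by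
  have hε := fermiEnergy_mem_Icc_of_pointBracketCheck hbr hν
  obtain ⟨-, -, -, hd, ht⟩ := scaleT_mem_of_scaleCheckPieces hsc ⟨le_rfl, le_rfl⟩ ⟨le_rfl, le_rfl⟩ ⟨le_rfl, le_rfl⟩
    ⟨le_rfl, le_rfl⟩ hε hx hy hP
  exact ⟨hε, hd, ht⟩

/-- **VELOCITY FAITHFULNESS AT A POINT ROW**: under the same two certificates, any two Fermi points satisfy
`scaleT(k) ≤ (1 + φ)·scaleT(k′)` — one `(t, t′)` reproduces the σ Fermi surface exactly and its velocity to the factor `1 + φ`.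
[folklore] -/
theorem pointScale_faithful_of_checks {Δ a b c e₁ e₂ ν₁ ν₂ lo hi φ : ℚ} {jout jin : List ℕ} {m : ℕ} {σ0s : List ℚ}
    (hbr : pointBracketCheck Δ a b c e₁ e₂ ν₁ ν₂ jout jin = true)
    (hsc : scaleCheckPieces Δ Δ a a b b c c e₁ e₂ m σ0s lo hi φ = true)
    {ε x y x' y' : ℝ} (hν : abFilling Δ a b c ε ∈ Set.Icc (ν₁ : ℝ) ν₂)
    (hx : x ∈ Set.Icc (0 : ℝ) 1) (hy : y ∈ Set.Icc (0 : ℝ) 1) (hP : charCubic Δ a b c x y ε = 0)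
    (hx' : x' ∈ Set.Icc (0 : ℝ) 1) (hy' : y' ∈ Set.Icc (0 : ℝ) 1) (hP' : charCubic Δ a b c x' y' ε = 0) :
    scaleT Δ a b c x y ε ≤ (1 + φ) * scaleT Δ a b c x' y' ε := by
  have hε := fermiEnergy_mem_Icc_of_pointBracketCheck hbr hν
  exact scaleT_le_mul_scaleT_of_checkPieces hsc ⟨le_rfl, le_rfl⟩ ⟨le_rfl, le_rfl⟩ ⟨le_rfl, le_rfl⟩ ⟨le_rfl, le_rfl⟩
    hε hx hy hP hx' hy' hP'

end Summit.Ventures.CertifiedManyBodySolver.Downfold.Emery
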